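import Summits.NavierStokesRegularity.NavierStokesRegularity.Theorems.SqueezeCycleExtremalBiaxialitySubcriticalSmallConstant
import Literature.Analysis.FluidPDE.StrainedAzimuthalFlow

/-!
# Crux `ExtremalBiaxialitySubcritical` (stmt-NavierStokesRegularity-11609), negative side:
# exact Navier–Stokes strain flows with a prescribed Leray-gauge middle eigenvalue

Route `SqueezeCycle`, crux
`Summit.NavierStokesRegularity.NavierStokesRegularity.Theses.SqueezeCycle.ExtremalBiaxialitySubcritical`:
"if `u ∈ 𝒦_C` attains at `(t₀, x₀)`, `t₀ < 0`, a Leray-gauge middle strain eigenvalue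
`Λ_u(t₀,x₀) ≥ m` (Courant–Fischer two-frame form) which is maximal over the class `𝒦_C`, then
`m < 1/8`". Extracted from the crux work file `Cruxes/ExtremalBiaxialitySubcritical/Disproof.lean`
(cdisprove adversary, generation 2, D-0016). This file exhibits the **perpetual squeeze machines
that live just outside the class** and uses them to certify which hypotheses of the crux carry its
content.

* `ampStrain c t x = c(t)·(x₀, x₁, −2x₂)` with pressure `ampPressure c c'` is, for EVERY amplitude
  `c` smooth on a time set `S` (derivative `c'`), an exact classical Navier–Stokes flow on `(EuclideanSpace ℝ (Fin 3)) × S`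
  (`isClassicalNSSolutionOn_ampStrain`: `∂ₜu = c'Dx`, `(u·∇)u = c²D²x`, `Δu = 0`,
  `∇p = −(c'D + c²D²)x`; a potential flow, `xᵀDx` harmonic). Its Leray-gauge middle strain
  eigenvalue is `Λ(t, x) = (−t)c(t)` at EVERY point (`ampStrain_lamGE` / `ampStrain_lamLE`, in the
  crux's own two-frame currency): the gauge history of `Λ` is an ARBITRARY smooth function of
  time, constant in space.
* `pulsedStrain m = ampStrain ((2+t)m)`: `Λ = (1 − (1+t)²)·m ≤ m`, `= m` exactly on the slice
  `t = −1` — a single record of any prescribed size `m`, regular at `t = 0`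
  (`isClassicalNSSolutionOn_pulsedStrain`, `pulsedStrain_attains`, `pulsedStrain_le`). At the
  record the gauge gradient is `m·diag(1,1,−2)` and (for `m = 1`) the pressure Hessian
  `−D − D² = −2·Id` is exactly isotropic: the Vieillefosse restricted-Euler fixed point dressed by
  the far field into a global exact flow.
* (sibling file `SelfSimilarStrain`): `c(t) = m/(−t)` gives Leray's backward self-similar flow
  with the LINEAR profile `U(y) = m D y`, `Λ ≡ m` on all of `(EuclideanSpace ℝ (Fin 3)) × (−∞, 0)` — every point a record.

Consequences for the crux (all hypotheses named as in the route file):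
* `not_selfExtremal` — replacing membership `u ∈ 𝒦_C` by "exact classical NS flow on
  `(EuclideanSpace ℝ (Fin 3)) × (−∞,0)`" and class-maximality by maximality over ALL space-time points of `u` itself (which
  is what every maximum-principle / comparison-along-the-flow argument uses, and equals maximality
  over the whole symmetry orbit of `u`, `Λ` being invariant under scaling, translation, rotation and
  lowered by past time-shifts) gives a FALSE statement, for every value `m > 0` (witness `m = 1`).
  Hence any proof must use the far-field / integrability content of `𝒦_C` (Type-I sup bound,
  Oseen representation, scaled energies) or compare the extremal element with genuinely DIFFERENT
  elements of the class; pointwise and jet-level optimality conditions at the record — to all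
  orders, with the exact dynamics — are void.
* `not_withoutMembership_of_class_trivial`, `false_without_membership_zero`,
  `false_without_membership_small`, `false_without_membership_of_squeezeLiouville` — keeping the
  GENUINE class-wide maximality clause over `𝒦_C` but dropping membership of the extremal element
  (replaced by "exact NS flow") is false whenever `𝒦_C = {0}`: unconditionally for `C = 0` and for
  `C ≤ ε` (the tree's `squeezeClass_eq_zero_of_small`), and for every `C` under the route target
  `SqueezeLiouville`. Membership is load-bearing exactly where the crux has content.

References: Vieillefosse, Physica A 125 (1984) 150–162; Cantwell, Phys. Fluids A 4 (1992)
782–793; Majda–Bertozzi, *Vorticity and Incompressible Flow* (2002) §1.4 (exact strain flows).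
-/

noncomputable section

open Set Function Filter MeasureTheory InnerProductSpace
open scoped Laplacian RealInnerProductSpace ContDiff

namespace Summit.NavierStokesRegularity.NavierStokesRegularity.Theorems.ExtremalBiaxialitySubcritical.Negative

open Literature.Analysis.FluidPDE
open Summit.NavierStokesRegularity.NavierStokesRegularity.Theses

/-! ### Amplitude-modulated biaxial strains are exact Navier–Stokes flows -/

/-- **Amplitude-modulated biaxial strain** `u_c(t, x) = c(t)·(x₀, x₁, −2x₂) = c(t) D x`,
`D = diag(1, 1, −2)` (the tree's `linearStrain (c t) (c t) (−2 c t)`). [folklore] -/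
def ampStrain (c : ℝ → ℝ) (t : ℝ) (x : (EuclideanSpace ℝ (Fin 3))) : (EuclideanSpace ℝ (Fin 3)) :=
  linearStrain (c t) (c t) (-(2 * c t)) x

/-- Its pressure `p(t, x) = −½ c'(t) xᵀDx − ½ c(t)² |Dx|²` (`c'` the derivative of `c`). [folklore] -/
def ampPressure (c c' : ℝ → ℝ) (t : ℝ) (x : (EuclideanSpace ℝ (Fin 3))) : ℝ :=
  -2⁻¹ * (c' t * x 0 ^ 2 + c' t * x 1 ^ 2 + (-(2 * c' t)) * x 2 ^ 2) +
    -2⁻¹ * ‖linearStrainL (c t) (c t) (-(2 * c t)) x‖ ^ 2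

/-- `D_{ca} x = c · D_a x`. [folklore] -/
theorem linearStrain_biaxial_mul (c a : ℝ) (x : (EuclideanSpace ℝ (Fin 3))) :
    linearStrain (c * a) (c * a) (-(2 * (c * a))) x = c • linearStrain a a (-(2 * a)) x := by
  ext i; fin_cases i <;> (simp [linearStrain]; ring)

/-- `D_a x = a · D_1 x`. [folklore] -/
theorem linearStrain_biaxial_eq_smul (a : ℝ) (x : (EuclideanSpace ℝ (Fin 3))) :
    linearStrain a a (-(2 * a)) x = a • linearStrain 1 1 (-(2 * 1)) x := by
  rw [← linearStrain_biaxial_mul, mul_one]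

variable {c c' : ℝ → ℝ}

/-- `∇u_c(t, x) = c(t) D`. [folklore] -/
theorem fderiv_ampStrain (c : ℝ → ℝ) (t : ℝ) (x : (EuclideanSpace ℝ (Fin 3))) :
    fderiv ℝ (ampStrain c t) x = linearStrainL (c t) (c t) (-(2 * c t)) :=
  (hasFDerivAt_linearStrain _ _ _ x).fderiv

/-- `div u_c = 0`. [folklore] -/
theorem isDivFree_ampStrain (c : ℝ → ℝ) (t : ℝ) : VectorCalculus.IsDivFree (ampStrain c t) := by
  intro x
  show VectorCalculus.divergence (linearStrain _ _ _) x = 0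
  rw [divergence_linearStrain]; ring

/-- `Δ u_c = 0` (linear field). [folklore] -/
theorem laplacian_ampStrain (c : ℝ → ℝ) (t : ℝ) (x : (EuclideanSpace ℝ (Fin 3))) : Δ (ampStrain c t) x = 0 :=
  StrainedAzimuthal.laplacian_linearStrainL _ _ _ x

/-- `(u_c·∇)u_c = c² D(Dx)`. [folklore] -/
theorem convect_ampStrain (c : ℝ → ℝ) (t : ℝ) (x : (EuclideanSpace ℝ (Fin 3))) :
    convect (ampStrain c t) (ampStrain c t) x =
      linearStrainL (c t) (c t) (-(2 * c t)) (linearStrain (c t) (c t) (-(2 * c t)) x) := by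
  rw [convect_apply, fderiv_ampStrain]
  rfl

/-- The gradient of the quadratic form `−½ a xᵀ D x = −½ a (x₀² + x₁² − 2x₂²)` is `−a D x`. [folklore] -/
theorem hasGradientAt_biaxialQuadForm (a : ℝ) (x : (EuclideanSpace ℝ (Fin 3))) :
    HasGradientAt (fun y : (EuclideanSpace ℝ (Fin 3)) => -2⁻¹ * (a * y 0 ^ 2 + a * y 1 ^ 2 + (-(2 * a)) * y 2 ^ 2))
      (-(linearStrain a a (-(2 * a)) x)) x := by
  rw [hasGradientAt_iff_hasFDerivAt]
  have h0 : HasFDerivAt (fun y : (EuclideanSpace ℝ (Fin 3)) => y 0) (StrainedAzimuthal.proj 0) x :=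
    (StrainedAzimuthal.proj 0).hasFDerivAt
  have h1 : HasFDerivAt (fun y : (EuclideanSpace ℝ (Fin 3)) => y 1) (StrainedAzimuthal.proj 1) x :=
    (StrainedAzimuthal.proj 1).hasFDerivAt
  have h2 : HasFDerivAt (fun y : (EuclideanSpace ℝ (Fin 3)) => y 2) (StrainedAzimuthal.proj 2) x :=
    (StrainedAzimuthal.proj 2).hasFDerivAt
  have h := ((((h0.pow 2).const_mul a).add ((h1.pow 2).const_mul a)).add
    ((h2.pow 2).const_mul (-(2 * a)))).const_mul (-2⁻¹ : ℝ)
  refine h.congr_fderiv ?_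
  ext h
  rw [toDual_apply_apply]
  simp [PiLp.inner_apply, Fin.sum_univ_three, linearStrain]
  ring

/-- `∇p = −(c' D x + c² D(Dx))`. [folklore] -/
theorem gradient_ampPressure (c c' : ℝ → ℝ) (t : ℝ) (x : (EuclideanSpace ℝ (Fin 3))) :
    gradient (ampPressure c c' t) x =
      -(linearStrain (c' t) (c' t) (-(2 * c' t)) x +
        linearStrainL (c t) (c t) (-(2 * c t)) (linearStrain (c t) (c t) (-(2 * c t)) x)) := by
  have h := (hasGradientAt_biaxialQuadForm (c' t) x).hasFDerivAt.add
    (StrainedAzimuthal.hasGradientAt_linearStrainPressure (c t) (c t) (-(2 * c t)) x).hasFDerivAt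
  rw [← map_add, ← neg_add] at h
  exact (hasGradientAt_iff_hasFDerivAt.2 h).gradient

/-- Joint smoothness of `u_c` on `S × (EuclideanSpace ℝ (Fin 3))` for `c` smooth on `S`. [folklore] -/
theorem contDiffOn_uncurry_ampStrain {S : Set ℝ} (hcs : ContDiffOn ℝ ∞ c S) :
    ContDiffOn ℝ ∞ (Function.uncurry (ampStrain c)) (S ×ˢ Set.univ) := by
  have h : Function.uncurry (ampStrain c) = fun q : ℝ × (EuclideanSpace ℝ (Fin 3)) => c q.1 • linearStrain 1 1 (-(2 * 1)) q.2 := by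
    funext q; exact linearStrain_biaxial_eq_smul (c q.1) q.2
  rw [h]
  exact (hcs.comp contDiffOn_fst fun q hq => (Set.mem_prod.mp hq).1).smul
    (((contDiff_linearStrain 1 1 (-(2 * 1))).comp contDiff_snd).contDiffOn)

/-- Joint smoothness of the pressure on `S × (EuclideanSpace ℝ (Fin 3))` for `c, c'` smooth on `S`. [folklore] -/
theorem contDiffOn_uncurry_ampPressure {S : Set ℝ} (hcs : ContDiffOn ℝ ∞ c S)
    (hc's : ContDiffOn ℝ ∞ c' S) :
    ContDiffOn ℝ ∞ (Function.uncurry (ampPressure c c')) (S ×ˢ Set.univ) := by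
  have h : Function.uncurry (ampPressure c c') = fun q : ℝ × (EuclideanSpace ℝ (Fin 3)) =>
      -2⁻¹ * (c' q.1 * q.2 0 ^ 2 + c' q.1 * q.2 1 ^ 2 + (-(2 * c' q.1)) * q.2 2 ^ 2) +
        -2⁻¹ * ‖c q.1 • linearStrain 1 1 (-(2 * 1)) q.2‖ ^ 2 := by
    funext ⟨t, x⟩
    simp only [Function.uncurry_apply_pair, ampPressure, linearStrainL_apply]
    rw [← linearStrain_biaxial_eq_smul]
  rw [h]
  have hx : ∀ i : Fin 3, ContDiffOn ℝ ∞ (fun q : ℝ × (EuclideanSpace ℝ (Fin 3)) => q.2 i) (S ×ˢ Set.univ) := fun i =>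
    ((contDiff_piLp_apply (p := 2) (i := i)).comp contDiff_snd).contDiffOn
  have hc1 : ContDiffOn ℝ ∞ (fun q : ℝ × (EuclideanSpace ℝ (Fin 3)) => c' q.1) (S ×ˢ Set.univ) :=
    hc's.comp contDiffOn_fst fun q hq => (Set.mem_prod.mp hq).1
  have hc0 : ContDiffOn ℝ ∞ (fun q : ℝ × (EuclideanSpace ℝ (Fin 3)) => c q.1) (S ×ˢ Set.univ) :=
    hcs.comp contDiffOn_fst fun q hq => (Set.mem_prod.mp hq).1
  refine (contDiffOn_const.mul ((((hc1.mul ((hx 0).pow 2)).add (hc1.mul ((hx 1).pow 2))).add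
    ((contDiffOn_const.mul hc1).neg.mul ((hx 2).pow 2))))).add
    (contDiffOn_const.mul (((contDiff_norm_sq ℝ).comp_contDiffOn
      (hc0.smul (((contDiff_linearStrain 1 1 (-(2 * 1))).comp contDiff_snd).contDiffOn)))))

/-- **Amplitude-modulated biaxial strains are exact classical Navier–Stokes flows** (viscosity
`1`, no force, the tree's `IsClassicalNSSolutionOn`) on `(EuclideanSpace ℝ (Fin 3)) × S` for every time set `S` of unique
differentiability (`Iio 0`, `univ`, …) and EVERY amplitude `c` smooth on `S` with derivative `c'`
there: `∂ₜu + (u·∇)u = c'Dx + c²D²x = −∇p`, `Δu = 0`, `div u = 0`. Equivalently `u = ∇φ`,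
`φ = ½c(t) xᵀDx` harmonic, `p = −∂ₜφ − ½|∇φ|²` (unsteady Bernoulli). [folklore] -/
theorem isClassicalNSSolutionOn_ampStrain {S : Set ℝ} (hS : UniqueDiffOn ℝ S)
    (hc : ∀ t ∈ S, HasDerivAt c (c' t) t) (hcs : ContDiffOn ℝ ∞ c S) (hc's : ContDiffOn ℝ ∞ c' S) :
    IsClassicalNSSolutionOn S 1 0 (ampStrain c) (ampPressure c c') where
  smooth_velocity := contDiffOn_uncurry_ampStrain hcs
  smooth_pressure := contDiffOn_uncurry_ampPressure hcs hc's
  momentum t ht x := by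
    have hd : timeDerivWithin S (ampStrain c) t x = linearStrain (c' t) (c' t) (-(2 * c' t)) x := by
      rw [timeDerivWithin_apply]
      have h : (fun s => ampStrain c s x) = fun s => c s • linearStrain 1 1 (-(2 * 1)) x :=
        funext fun s => linearStrain_biaxial_eq_smul (c s) x
      rw [h, linearStrain_biaxial_eq_smul (c' t)]
      exact ((hc t ht).smul_const _).hasDerivWithinAt.derivWithin (hS t ht)
    rw [hd, convect_ampStrain, laplacian_ampStrain, gradient_ampPressure, smul_zero, zero_sub,
      neg_neg]
    simp only [Pi.zero_apply, add_zero]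
  divFree t _ := isDivFree_ampStrain c t

/-! ### The two-frame (Courant–Fischer) clauses of the crux for `u_c`: `Λ ≡ (−t) c(t)` -/

/-- `⟪e₀, e₁⟫ = 0`. [folklore] -/
theorem inner_single_zero_one :
    inner ℝ (EuclideanSpace.single 0 (1 : ℝ) : (EuclideanSpace ℝ (Fin 3))) (EuclideanSpace.single 1 (1 : ℝ)) = 0 := by
  simp [EuclideanSpace.inner_single_left]
/-- `⟪e₁, e₂⟫ = 0`. [folklore] -/
theorem inner_single_one_two :
    inner ℝ (EuclideanSpace.single 1 (1 : ℝ) : (EuclideanSpace ℝ (Fin 3))) (EuclideanSpace.single 2 (1 : ℝ)) = 0 := by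
  simp [EuclideanSpace.inner_single_left]

/-- On the plane `span(e₀, e₁)` the quadratic form of `D_a` is `a|ξ|²`. [folklore] -/
theorem inner_linearStrain_frame01 (a α β : ℝ) :
    inner ℝ (linearStrainL a a (-(2 * a))
        (α • (EuclideanSpace.single 0 (1 : ℝ) : (EuclideanSpace ℝ (Fin 3))) + β • EuclideanSpace.single 1 (1 : ℝ)))
      (α • (EuclideanSpace.single 0 (1 : ℝ) : (EuclideanSpace ℝ (Fin 3))) + β • EuclideanSpace.single 1 (1 : ℝ)) =
      a * (α ^ 2 + β ^ 2) := by
  simp [linearStrain, PiLp.inner_apply, Fin.sum_univ_three]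
  ring

/-- On the plane `span(e₁, e₂)` the quadratic form of `D_a` is `aα² − 2aβ²`. [folklore] -/
theorem inner_linearStrain_frame12 (a α β : ℝ) :
    inner ℝ (linearStrainL a a (-(2 * a))
        (α • (EuclideanSpace.single 1 (1 : ℝ) : (EuclideanSpace ℝ (Fin 3))) + β • EuclideanSpace.single 2 (1 : ℝ)))
      (α • (EuclideanSpace.single 1 (1 : ℝ) : (EuclideanSpace ℝ (Fin 3))) + β • EuclideanSpace.single 2 (1 : ℝ)) =
      a * α ^ 2 - 2 * a * β ^ 2 := by
  simp [linearStrain, PiLp.inner_apply, Fin.sum_univ_three]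
  ring

/-- **`Λ_{u_c}(t, x) ≥ (−t)c(t)` at every point** — the crux's lower two-frame clause
("`∃` orthonormal `v, w`, `∀ α β`, `m(α²+β²) ≤ (−t)⟪∇u (αv+βw), αv+βw⟫`") with the value
`m = (−t)c(t)`, frame `(e₀, e₁)`. [folklore] -/
theorem ampStrain_lamGE (c : ℝ → ℝ) (t : ℝ) (x : (EuclideanSpace ℝ (Fin 3))) :
    ∃ v w : (EuclideanSpace ℝ (Fin 3)), ‖v‖ = 1 ∧ ‖w‖ = 1 ∧ inner ℝ v w = 0 ∧ ∀ α β : ℝ,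
      ((-t) * c t) * (α ^ 2 + β ^ 2) ≤ (-t) *
        inner ℝ (fderiv ℝ (ampStrain c t) x (α • v + β • w)) (α • v + β • w) := by
  refine ⟨EuclideanSpace.single 0 1, EuclideanSpace.single 1 1, (by simp),
    (by simp), inner_single_zero_one, fun α β => ?_⟩
  rw [fderiv_ampStrain, inner_linearStrain_frame01, mul_assoc]

/-- **`Λ_{u_c}(t, x) ≤ M` at every point, for every `M ≥ 0` with `(−t)c(t) ≤ M`** — the crux's
upper two-frame clause (frame `(e₁, e₂)` where `(−t)c(t) ≥ 0`, frame `(e₀, e₁)` where it is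
negative). With `ampStrain_lamGE`: the Leray-gauge middle strain eigenvalue of `u_c` is EXACTLY
`(−t)c(t)`, constant in space, an arbitrary smooth function of time. [folklore] -/
theorem ampStrain_lamLE (c : ℝ → ℝ) {M t : ℝ} (hM : 0 ≤ M) (hle : (-t) * c t ≤ M) (x : (EuclideanSpace ℝ (Fin 3))) :
    ∃ v w : (EuclideanSpace ℝ (Fin 3)), ‖v‖ = 1 ∧ ‖w‖ = 1 ∧ inner ℝ v w = 0 ∧ ∀ α β : ℝ,
      (-t) * inner ℝ (fderiv ℝ (ampStrain c t) x (α • v + β • w)) (α • v + β • w) ≤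
        M * (α ^ 2 + β ^ 2) := by
  rw [fderiv_ampStrain]
  by_cases hg : 0 ≤ (-t) * c t
  · refine ⟨EuclideanSpace.single 1 1, EuclideanSpace.single 2 1, (by simp),
      (by simp), inner_single_one_two, fun α β => ?_⟩
    rw [inner_linearStrain_frame12]
    have e : (-t) * (c t * α ^ 2 - 2 * c t * β ^ 2) =
        ((-t) * c t) * α ^ 2 - 2 * ((-t) * c t) * β ^ 2 := by ring
    rw [e]
    nlinarith [mul_nonneg hg (sq_nonneg β), mul_le_mul_of_nonneg_right hle (sq_nonneg α),
      mul_nonneg hM (sq_nonneg β)]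
  · refine ⟨EuclideanSpace.single 0 1, EuclideanSpace.single 1 1, (by simp),
      (by simp), inner_single_zero_one, fun α β => ?_⟩
    rw [inner_linearStrain_frame01, ← mul_assoc]
    rw [not_le] at hg
    have hs : 0 ≤ α ^ 2 + β ^ 2 := by positivity
    nlinarith [mul_nonneg hM hs, mul_nonpos_of_nonpos_of_nonneg hg.le hs]

/-! ### The pulse `c(t) = (2 + t) m`: one record of size `m`, regular at `t = 0` -/

/-- **The pulsed biaxial strain** `u_m(t, x) = (2 + t) m (x₀, x₁, −2x₂)`. [folklore] -/
def pulsedStrain (m : ℝ) : ℝ → (EuclideanSpace ℝ (Fin 3)) → (EuclideanSpace ℝ (Fin 3)) := ampStrain fun t => (2 + t) * m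

/-- Its pressure. [folklore] -/
def pulsedPressure (m : ℝ) : ℝ → (EuclideanSpace ℝ (Fin 3)) → ℝ := ampPressure (fun t => (2 + t) * m) fun _ => m

/-- `d/dt ((2 + t) m) = m`. [folklore] -/
theorem hasDerivAt_pulse (m t : ℝ) : HasDerivAt (fun t => (2 + t) * m) m t := by
  simpa using ((hasDerivAt_id t).const_add 2).mul_const m

/-- **The pulsed strain is an exact classical Navier–Stokes flow on `(EuclideanSpace ℝ (Fin 3)) × (−∞, 0)`.** [folklore] -/
theorem isClassicalNSSolutionOn_pulsedStrain (m : ℝ) :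
    IsClassicalNSSolutionOn (Set.Iio 0) 1 0 (pulsedStrain m) (pulsedPressure m) :=
  isClassicalNSSolutionOn_ampStrain (uniqueDiffOn_Iio 0) (fun t _ => hasDerivAt_pulse m t)
    ((contDiff_const.add contDiff_id).mul contDiff_const).contDiffOn contDiffOn_const

/-- **Attainment: `Λ_{u_m}(−1, x₀) ≥ m`** (any `x₀`) — the crux's lower clause at `t₀ = −1`. [folklore] -/
theorem pulsedStrain_attains (m : ℝ) (x₀ : (EuclideanSpace ℝ (Fin 3))) :
    ∃ v w : (EuclideanSpace ℝ (Fin 3)), ‖v‖ = 1 ∧ ‖w‖ = 1 ∧ inner ℝ v w = 0 ∧ ∀ α β : ℝ,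
      m * (α ^ 2 + β ^ 2) ≤ (-(-1 : ℝ)) *
        inner ℝ (fderiv ℝ (pulsedStrain m (-1)) x₀ (α • v + β • w)) (α • v + β • w) := by
  have h := ampStrain_lamGE (fun t => (2 + t) * m) (-1) x₀
  norm_num at h
  simpa [pulsedStrain] using h

/-- **Self-maximality: `Λ_{u_m}(t, x) ≤ m` at EVERY `t < 0`, `x`** (`m ≥ 0`; the gauge weight is
`(−t)(2+t) = 1 − (1+t)² ≤ 1`) — the crux's upper clause, for `u_m` itself. [folklore] -/
theorem pulsedStrain_le {m : ℝ} (hm : 0 ≤ m) (t : ℝ) (x : (EuclideanSpace ℝ (Fin 3))) :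
    ∃ v w : (EuclideanSpace ℝ (Fin 3)), ‖v‖ = 1 ∧ ‖w‖ = 1 ∧ inner ℝ v w = 0 ∧ ∀ α β : ℝ,
      (-t) * inner ℝ (fderiv ℝ (pulsedStrain m t) x (α • v + β • w)) (α • v + β • w) ≤
        m * (α ^ 2 + β ^ 2) :=
  ampStrain_lamLE _ hm (by nlinarith [sq_nonneg (1 + t)]) x

/-! ### Consequence 1: self-maximality along an exact flow forces nothing -/

/-- **`SelfExtremal` is false.** The crux with (i) membership `u ∈ 𝒦_C` replaced by "`(u, p)` is an
exact classical Navier–Stokes flow on `(EuclideanSpace ℝ (Fin 3)) × (−∞, 0)`" and (ii) class-maximality weakened to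
maximality of the attained value over ALL space-time points of `u` itself (both two-frame clauses
verbatim) FAILS: the pulsed strain `u₁` attains `Λ = 1 ≥ 1/8` at `(−1, 0)` and has `Λ ≤ 1`
everywhere. Since `Λ` is invariant under the Navier–Stokes scaling, translations and rotations and
is lowered by past time-shifts, (ii) is the same as maximality over the whole admissible symmetry
orbit of `u`. Any proof of the crux must therefore use the far-field content of `𝒦_C` or genuinely
different competitors — not optimality conditions at the record, to any order. [folklore] -/
theorem not_selfExtremal :
    ¬ ∀ (m : ℝ) (u : ℝ → (EuclideanSpace ℝ (Fin 3)) → (EuclideanSpace ℝ (Fin 3))) (p : ℝ → (EuclideanSpace ℝ (Fin 3)) → ℝ) (t₀ : ℝ) (x₀ : (EuclideanSpace ℝ (Fin 3))), t₀ < 0 →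
      IsClassicalNSSolutionOn (Set.Iio 0) 1 0 u p →
      (∃ v w : (EuclideanSpace ℝ (Fin 3)), ‖v‖ = 1 ∧ ‖w‖ = 1 ∧ inner ℝ v w = 0 ∧ ∀ α β : ℝ,
        m * (α ^ 2 + β ^ 2) ≤ (-t₀) * inner ℝ (fderiv ℝ (u t₀) x₀ (α • v + β • w)) (α • v + β • w)) →
      (∀ t < 0, ∀ x, ∃ v w : (EuclideanSpace ℝ (Fin 3)), ‖v‖ = 1 ∧ ‖w‖ = 1 ∧ inner ℝ v w = 0 ∧ ∀ α β : ℝ,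
        (-t) * inner ℝ (fderiv ℝ (u t) x (α • v + β • w)) (α • v + β • w) ≤ m * (α ^ 2 + β ^ 2)) →
      m < 1 / 8 := by
  intro h
  have := h 1 (pulsedStrain 1) (pulsedPressure 1) (-1) 0 (by norm_num)
    (isClassicalNSSolutionOn_pulsedStrain 1) (pulsedStrain_attains 1 0)
    (fun t _ x => pulsedStrain_le zero_le_one t x)
  norm_num at this

/-! ### Consequence 2: membership is load-bearing even against genuine class-maximality -/

/-- The crux's upper two-frame clause holds (any `m ≥ 0`) wherever the slice vanishes identically. [folklore] -/
theorem upper_clause_of_slice_zero {m : ℝ} (hm : 0 ≤ m) {v' : ℝ → (EuclideanSpace ℝ (Fin 3)) → (EuclideanSpace ℝ (Fin 3))} {t : ℝ}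
    (hz : ∀ x, v' t x = 0) (x : (EuclideanSpace ℝ (Fin 3))) :
    ∃ v w : (EuclideanSpace ℝ (Fin 3)), ‖v‖ = 1 ∧ ‖w‖ = 1 ∧ inner ℝ v w = 0 ∧ ∀ α β : ℝ,
      (-t) * inner ℝ (fderiv ℝ (v' t) x (α • v + β • w)) (α • v + β • w) ≤ m * (α ^ 2 + β ^ 2) := by
  refine ⟨EuclideanSpace.single 0 1, EuclideanSpace.single 1 1, (by simp),
    (by simp), inner_single_zero_one, fun α β => ?_⟩
  have h0 : v' t = fun _ => 0 := funext hz
  have h1 : fderiv ℝ (fun _ : (EuclideanSpace ℝ (Fin 3)) => (0 : (EuclideanSpace ℝ (Fin 3)))) x = 0 := by simp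
  have h2 : 0 ≤ m * (α ^ 2 + β ^ 2) := by positivity
  rw [h0, h1]
  simpa using h2

/-- A field with Type-I time decay of constant `0` vanishes on `t < 0`. [folklore] -/
theorem slice_zero_of_hasTypeITimeDecay_zero {v' : ℝ → (EuclideanSpace ℝ (Fin 3)) → (EuclideanSpace ℝ (Fin 3))} (h : HasTypeITimeDecay 0 v')
    {t : ℝ} (ht : t < 0) (x : (EuclideanSpace ℝ (Fin 3))) : v' t x = 0 := by
  have := h t ht x
  rw [zero_div] at this
  exact norm_le_zero_iff.1 this

/-- **If `𝒦_C = {0}`, membership is all that separates the crux from a counterexample.** The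
statement "`u` an exact classical NS flow on `(EuclideanSpace ℝ (Fin 3)) × (−∞,0)` (in place of `u ∈ 𝒦_C`) attaining
`Λ_u(t₀,x₀) ≥ m`, with `m` GENUINELY class-maximal over `𝒦_C` (the crux's clause verbatim)
`⇒ m < 1/8`" is false as soon as every element of `𝒦_C` vanishes on `t < 0`: witness the pulsed
strain, `m = 1`. [folklore] -/
theorem not_withoutMembership_of_class_trivial {C : ℝ}
    (htriv : ∀ v' : ℝ → EuclideanSpace ℝ (Fin 3) → EuclideanSpace ℝ (Fin 3), (ContDiffOn ℝ (⊤ : ℕ∞) (Function.uncurry v') (Set.Iio 0 ×ˢ Set.univ) ∧ (∀ t < 0, Literature.Analysis.FluidPDE.VectorCalculus.IsDivFree (v' t)) ∧ (∀ s t : ℝ, s < t → t < 0 → ∀ x, v' t x = Literature.Analysis.FluidPDE.heatFlow (v' s) (t-s) x - ∫ τ in Set.Ioo s t, ∫ y, ((-(inner ℝ (x-y) (v' τ y) / (2*(t-τ)) * Literature.Analysis.UnboundedOperators.heatKernel (t-τ) (x-y))) • v' τ y + (∫ σ in Set.Ioi (t-τ), Literature.Analysis.UnboundedOperators.heatKernel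 σ (x-y) / (4*σ^2)) • (inner ℝ (x-y) (v' τ y) • v' τ y + inner ℝ (v' τ y) (v' τ y) • (x-y) + inner ℝ (x-y) (v' τ y) • v' τ y) - ((∫ σ in Set.Ioi (t-τ), Literature.Analysis.UnboundedOperators.heatKernel σ (x-y) / (8*σ^3)) * (inner ℝ (x-y) (v' τ y) * inner ℝ (x-y) (v' τ y))) • (x-y))) ∧ Literature.Analysis.FluidPDE.HasTypeITimeDecay C v' ∧ (∀ (x₀ : EuclideanSpace ℝ (Fin 3)) (t₀ r : ℝ), t₀ ≤ 0 → 0 < r → (∀ t, t₀ - r^2 < t → t < t₀ → r⁻¹ * ∫ x in Metric.ball x₀ r, ‖v' t x‖^2 ≤ C) ∧ r⁻¹ * ∫ t in Set.Ioo (t₀ - r^2) t₀, ∫ x in Metric.ball x₀ r, ‖fderiv ℝ (v' t) x‖^2 ≤ C)) → ∀ t < 0, ∀ x, v' t x = 0) :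
    ¬ ∀ (m : ℝ) (u : ℝ → (EuclideanSpace ℝ (Fin 3)) → (EuclideanSpace ℝ (Fin 3))) (t₀ : ℝ) (x₀ : (EuclideanSpace ℝ (Fin 3))), t₀ < 0 →
      (∃ p : ℝ → (EuclideanSpace ℝ (Fin 3)) → ℝ, IsClassicalNSSolutionOn (Set.Iio 0) 1 0 u p) →
      (∃ v w : EuclideanSpace ℝ (Fin 3), ‖v‖ = 1 ∧ ‖w‖ = 1 ∧ inner ℝ v w = 0 ∧ ∀ α β : ℝ, m * (α^2 + β^2) ≤ (-t₀) * inner ℝ (fderiv ℝ (u t₀) x₀ (α • v + β • w)) (α • v + β • w)) →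
      (∀ v' : ℝ → EuclideanSpace ℝ (Fin 3) → EuclideanSpace ℝ (Fin 3), ContDiffOn ℝ (⊤ : ℕ∞) (Function.uncurry v') (Set.Iio 0 ×ˢ Set.univ) ∧ (∀ t < 0, Literature.Analysis.FluidPDE.VectorCalculus.IsDivFree (v' t)) ∧ (∀ s t : ℝ, s < t → t < 0 → ∀ x, v' t x = Literature.Analysis.FluidPDE.heatFlow (v' s) (t-s) x - ∫ τ in Set.Ioo s t, ∫ y, ((-(inner ℝ (x-y) (v' τ y) / (2*(t-τ)) * Literature.Analysis.UnboundedOperators.heatKernel (t-τ) (x-y))) • v' τ y + (∫ σ in Set.Ioi (t-τ), Literature.Analysis.UnboundedOperators.heatKernel σ (x-y) / (4*σ^2)) • (inner ℝ (x-y) (v' τ y) • v' τ y + inner ℝ (v' τ y) (v' τ y) • (x-y) + inner ℝ (x-y) (v' τ y) • v' τ y) - ((∫ σ in Set.Ioi (t-τ), Literature.Analysis.UnboundedOperators.heatKernel σ (x-y) / (8*σ^3)) * (inner ℝ (x-y) (v' τ y) * inner ℝ (x-y) (v' τ y))) • (x-y))) ∧ Literature.Analysis.FluidPDE.HasTypeITimeDecay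 C v' ∧ (∀ (x₀ : EuclideanSpace ℝ (Fin 3)) (t₀ r : ℝ), t₀ ≤ 0 → 0 < r → (∀ t, t₀ - r^2 < t → t < t₀ → r⁻¹ * ∫ x in Metric.ball x₀ r, ‖v' t x‖^2 ≤ C) ∧ r⁻¹ * ∫ t in Set.Ioo (t₀ - r^2) t₀, ∫ x in Metric.ball x₀ r, ‖fderiv ℝ (v' t) x‖^2 ≤ C) → ∀ t < 0, ∀ x, (∃ v w : EuclideanSpace ℝ (Fin 3), ‖v‖ = 1 ∧ ‖w‖ = 1 ∧ inner ℝ v w = 0 ∧ ∀ α β : ℝ, (-t) * inner ℝ (fderiv ℝ (v' t) x (α • v + β • w)) (α • v + β • w) ≤ m * (α^2 + β^2))) →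
      m < 1 / 8 := by
  intro h
  have := h 1 (pulsedStrain 1) (-1) 0 (by norm_num)
    ⟨pulsedPressure 1, isClassicalNSSolutionOn_pulsedStrain 1⟩ (pulsedStrain_attains 1 0)
    (fun v' hv' t ht x => upper_clause_of_slice_zero zero_le_one (fun y => htriv v' hv' t ht y) x)
  norm_num at this

/-- **Membership is load-bearing at `C = 0`** (`𝒦_0 = {0}` by the Type-I rate alone; the class
is inhabited by `0`, so the maximality clause is genuinely tested). [folklore] -/
theorem false_without_membership_zero :
    ¬ ∀ (m : ℝ) (u : ℝ → (EuclideanSpace ℝ (Fin 3)) → (EuclideanSpace ℝ (Fin 3))) (t₀ : ℝ) (x₀ : (EuclideanSpace ℝ (Fin 3))), t₀ < 0 →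
      (∃ p : ℝ → (EuclideanSpace ℝ (Fin 3)) → ℝ, IsClassicalNSSolutionOn (Set.Iio 0) 1 0 u p) →
      (∃ v w : EuclideanSpace ℝ (Fin 3), ‖v‖ = 1 ∧ ‖w‖ = 1 ∧ inner ℝ v w = 0 ∧ ∀ α β : ℝ, m * (α^2 + β^2) ≤ (-t₀) * inner ℝ (fderiv ℝ (u t₀) x₀ (α • v + β • w)) (α • v + β • w)) →
      (∀ v' : ℝ → EuclideanSpace ℝ (Fin 3) → EuclideanSpace ℝ (Fin 3), ContDiffOn ℝ (⊤ : ℕ∞) (Function.uncurry v') (Set.Iio 0 ×ˢ Set.univ) ∧ (∀ t < 0, Literature.Analysis.FluidPDE.VectorCalculus.IsDivFree (v' t)) ∧ (∀ s t : ℝ, s < t → t < 0 → ∀ x, v' t x = Literature.Analysis.FluidPDE.heatFlow (v' s) (t-s) x - ∫ τ in Set.Ioo s t, ∫ y, ((-(inner ℝ (x-y) (v' τ y) / (2*(t-τ)) * Literature.Analysis.UnboundedOperators.heatKernel (t-τ) (x-y))) • v' τ y + (∫ σ in Set.Ioi (t-τ), Literature.Analysis.UnboundedOperators.heatKernel σ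 (x-y) / (4*σ^2)) • (inner ℝ (x-y) (v' τ y) • v' τ y + inner ℝ (v' τ y) (v' τ y) • (x-y) + inner ℝ (x-y) (v' τ y) • v' τ y) - ((∫ σ in Set.Ioi (t-τ), Literature.Analysis.UnboundedOperators.heatKernel σ (x-y) / (8*σ^3)) * (inner ℝ (x-y) (v' τ y) * inner ℝ (x-y) (v' τ y))) • (x-y))) ∧ Literature.Analysis.FluidPDE.HasTypeITimeDecay 0 v' ∧ (∀ (x₀ : EuclideanSpace ℝ (Fin 3)) (t₀ r : ℝ), t₀ ≤ 0 → 0 < r → (∀ t, t₀ - r^2 < t → t < t₀ → r⁻¹ * ∫ x in Metric.ball x₀ r, ‖v' t x‖^2 ≤ 0) ∧ r⁻¹ * ∫ t in Set.Ioo (t₀ - r^2) t₀, ∫ x in Metric.ball x₀ r, ‖fderiv ℝ (v' t) x‖^2 ≤ 0) → ∀ t < 0, ∀ x, (∃ v w : EuclideanSpace ℝ (Fin 3), ‖v‖ = 1 ∧ ‖w‖ = 1 ∧ inner ℝ v w = 0 ∧ ∀ α β : ℝ, (-t) * inner ℝ (fderiv ℝ (v' t) x (α • v + β • w)) (α • v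 + β • w) ≤ m * (α^2 + β^2))) →
      m < 1 / 8 :=
  not_withoutMembership_of_class_trivial fun _ hv' _ ht x =>
    slice_zero_of_hasTypeITimeDecay_zero hv'.2.2.2.1 ht x

/-- **Membership is load-bearing for every small Type-I constant `C ≤ ε`** (`𝒦_C = {0}` there,
unconditionally: the tree's `squeezeClass_eq_zero_of_small`, Leray halving). [folklore] -/
theorem false_without_membership_small :
    ∃ ε : ℝ, 0 < ε ∧ ∀ C : ℝ, C ≤ ε →
    ¬ ∀ (m : ℝ) (u : ℝ → (EuclideanSpace ℝ (Fin 3)) → (EuclideanSpace ℝ (Fin 3))) (t₀ : ℝ) (x₀ : (EuclideanSpace ℝ (Fin 3))), t₀ < 0 →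
      (∃ p : ℝ → (EuclideanSpace ℝ (Fin 3)) → ℝ, IsClassicalNSSolutionOn (Set.Iio 0) 1 0 u p) →
      (∃ v w : EuclideanSpace ℝ (Fin 3), ‖v‖ = 1 ∧ ‖w‖ = 1 ∧ inner ℝ v w = 0 ∧ ∀ α β : ℝ, m * (α^2 + β^2) ≤ (-t₀) * inner ℝ (fderiv ℝ (u t₀) x₀ (α • v + β • w)) (α • v + β • w)) →
      (∀ v' : ℝ → EuclideanSpace ℝ (Fin 3) → EuclideanSpace ℝ (Fin 3), ContDiffOn ℝ (⊤ : ℕ∞) (Function.uncurry v') (Set.Iio 0 ×ˢ Set.univ) ∧ (∀ t < 0, Literature.Analysis.FluidPDE.VectorCalculus.IsDivFree (v' t)) ∧ (∀ s t : ℝ, s < t → t < 0 → ∀ x, v' t x = Literature.Analysis.FluidPDE.heatFlow (v' s) (t-s) x - ∫ τ in Set.Ioo s t, ∫ y, ((-(inner ℝ (x-y) (v' τ y) / (2*(t-τ)) * Literature.Analysis.UnboundedOperators.heatKernel (t-τ) (x-y))) • v' τ y + (∫ σ in Set.Ioi (t-τ), Literature.Analysis.UnboundedOperators.heatKernel σ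 (x-y) / (4*σ^2)) • (inner ℝ (x-y) (v' τ y) • v' τ y + inner ℝ (v' τ y) (v' τ y) • (x-y) + inner ℝ (x-y) (v' τ y) • v' τ y) - ((∫ σ in Set.Ioi (t-τ), Literature.Analysis.UnboundedOperators.heatKernel σ (x-y) / (8*σ^3)) * (inner ℝ (x-y) (v' τ y) * inner ℝ (x-y) (v' τ y))) • (x-y))) ∧ Literature.Analysis.FluidPDE.HasTypeITimeDecay C v' ∧ (∀ (x₀ : EuclideanSpace ℝ (Fin 3)) (t₀ r : ℝ), t₀ ≤ 0 → 0 < r → (∀ t, t₀ - r^2 < t → t < t₀ → r⁻¹ * ∫ x in Metric.ball x₀ r, ‖v' t x‖^2 ≤ C) ∧ r⁻¹ * ∫ t in Set.Ioo (t₀ - r^2) t₀, ∫ x in Metric.ball x₀ r, ‖fderiv ℝ (v' t) x‖^2 ≤ C) → ∀ t < 0, ∀ x, (∃ v w : EuclideanSpace ℝ (Fin 3), ‖v‖ = 1 ∧ ‖w‖ = 1 ∧ inner ℝ v w = 0 ∧ ∀ α β : ℝ, (-t) * inner ℝ (fderiv ℝ (v' t) x (α • v + β • w)) (α • v + β • w)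 ≤ m * (α^2 + β^2))) →
      m < 1 / 8 := by
  obtain ⟨ε, hε, hsmall⟩ := squeezeClass_eq_zero_of_small
  exact ⟨ε, hε, fun C hC => not_withoutMembership_of_class_trivial fun v' hv' t ht x =>
    hsmall C v' hC hv' t ht x⟩

/-- **Membership is load-bearing at EVERY constant in the Liouville world**: under the route
target `SqueezeLiouville` (every element of every `𝒦_C` vanishes) the crux is TRUE for the trivial
reason `m ≤ 0` (`extremalBiaxialitySubcritical_of_squeezeLiouville`) — and for that reason only:
dropping membership of the extremal element makes it false at every `C`. [folklore] -/
theorem false_without_membership_of_squeezeLiouville (hL : SqueezeCycle.SqueezeLiouville) (C : ℝ) :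
    ¬ ∀ (m : ℝ) (u : ℝ → (EuclideanSpace ℝ (Fin 3)) → (EuclideanSpace ℝ (Fin 3))) (t₀ : ℝ) (x₀ : (EuclideanSpace ℝ (Fin 3))), t₀ < 0 →
      (∃ p : ℝ → (EuclideanSpace ℝ (Fin 3)) → ℝ, IsClassicalNSSolutionOn (Set.Iio 0) 1 0 u p) →
      (∃ v w : EuclideanSpace ℝ (Fin 3), ‖v‖ = 1 ∧ ‖w‖ = 1 ∧ inner ℝ v w = 0 ∧ ∀ α β : ℝ, m * (α^2 + β^2) ≤ (-t₀) * inner ℝ (fderiv ℝ (u t₀) x₀ (α • v + β • w)) (α • v + β • w)) →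
      (∀ v' : ℝ → EuclideanSpace ℝ (Fin 3) → EuclideanSpace ℝ (Fin 3), ContDiffOn ℝ (⊤ : ℕ∞) (Function.uncurry v') (Set.Iio 0 ×ˢ Set.univ) ∧ (∀ t < 0, Literature.Analysis.FluidPDE.VectorCalculus.IsDivFree (v' t)) ∧ (∀ s t : ℝ, s < t → t < 0 → ∀ x, v' t x = Literature.Analysis.FluidPDE.heatFlow (v' s) (t-s) x - ∫ τ in Set.Ioo s t, ∫ y, ((-(inner ℝ (x-y) (v' τ y) / (2*(t-τ)) * Literature.Analysis.UnboundedOperators.heatKernel (t-τ) (x-y))) • v' τ y + (∫ σ in Set.Ioi (t-τ), Literature.Analysis.UnboundedOperators.heatKernel σ (x-y) / (4*σ^2)) • (inner ℝ (x-y) (v' τ y) • v' τ y + inner ℝ (v' τ y) (v' τ y) • (x-y) + inner ℝ (x-y) (v' τ y) • v' τ y) - ((∫ σ in Set.Ioi (t-τ), Literature.Analysis.UnboundedOperators.heatKernel σ (x-y) / (8*σ^3)) * (inner ℝ (x-y) (v' τ y) * inner ℝ (x-y) (v' τ y))) • (x-y))) ∧ Literature.Analysis.FluidPDE.HasTypeITimeDecay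 C v' ∧ (∀ (x₀ : EuclideanSpace ℝ (Fin 3)) (t₀ r : ℝ), t₀ ≤ 0 → 0 < r → (∀ t, t₀ - r^2 < t → t < t₀ → r⁻¹ * ∫ x in Metric.ball x₀ r, ‖v' t x‖^2 ≤ C) ∧ r⁻¹ * ∫ t in Set.Ioo (t₀ - r^2) t₀, ∫ x in Metric.ball x₀ r, ‖fderiv ℝ (v' t) x‖^2 ≤ C) → ∀ t < 0, ∀ x, (∃ v w : EuclideanSpace ℝ (Fin 3), ‖v‖ = 1 ∧ ‖w‖ = 1 ∧ inner ℝ v w = 0 ∧ ∀ α β : ℝ, (-t) * inner ℝ (fderiv ℝ (v' t) x (α • v + β • w)) (α • v + β • w) ≤ m * (α^2 + β^2))) →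
      m < 1 / 8 :=
  not_withoutMembership_of_class_trivial fun v' hv' t ht x => hL C v' hv' t ht x

end Summit.NavierStokesRegularity.NavierStokesRegularity.Theorems.ExtremalBiaxialitySubcritical.Negative

end
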